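import Summits.AtomisticToContinuum.Crystallization.Theorems.FreeSplittingCertificatesStrictSplittingRuleP1CellVarianceW

/-!
# `StrictSplittingRule` (stmt-AtomisticToContinuum-12560): the vertex-quadrature excess with a POINTWISE weight majorant — defect `≤ ¼(∫_T ω)·½Σ|v_m − v_{m'}|²` (P1 interpolant object, part 28)

Route `FreeSplittingCertificates`, crux r3 `StrictSplittingRule` (H12⋆ = `stub_coreJointCoercive`), unit b2b-freesplit-B gen 22.
VALUE = the variant of part 25 that survives at the INNER EDGE of the layer (HOME FAR-LEMMA-SPEC §17 (h)): instead of a constant bound `w_T` of the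
weight on the cell (whose ratio to the cell's readout weight `∫_T χ²r⁻⁶` is unbounded where `χ → 0`), use a pointwise majorant `q_{W(y)}(u) ≤ ω(y)|u|²`
(in the assembly `ω = 2χ²|y|⁻⁸`, the SAME `χ²` as the readout density) and `λ_mλ_{m'} ≤ ¼` on the cell:
`Σ_m ∫_T λ_m·q_W(v_m) ≤ ∫_T q_W(ṽ) + ¼(∫_T ω)·½Σ_{m,m'}|v_m − v_{m'}|²`  (**`vertex_quadrature_excess_fun_p1RealCell`**);
then `¼∫_T 2χ²r⁻⁸ ≤ ½ r_min(T)⁻²∫_T χ²r⁻⁶` charges the defect to the readout inflation `f` cell by cell with no `χ`-ratio.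
NOT a proof of H12⋆, NOT summit progress.  [folklore]
-/

noncomputable section

open Set Function Metric MeasureTheory Filter Topology
open scoped BigOperators NNReal ENNReal

namespace Summit.AtomisticToContinuum.Crystallization.Theorems.StrictSplittingRuleBirth

/-- On the cell, the product of two DISTINCT hat functions is at most `¼` (they are nonnegative and sum, with the other two, to `1`). -/
theorem p1Lam_mul_le_quarter {a h : ℝ} {i : (ℤ × ℤ × ℤ) × Fin 6} {y : Fin 3 → ℝ} (hy : y ∈ p1RealCell a h i) {m m' : Fin 4} (hne : m ≠ m') :
    p1Lam a h i m y * p1Lam a h i m' y ≤ 1 / 4 := by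
  have hsum := sum_p1Lam_eq_one a h i y
  have h0 : ∀ k, 0 ≤ p1Lam a h i k y := fun k => p1Lam_nonneg_of_mem hy k
  -- λ_m + λ_{m'} ≤ 1
  have hle : p1Lam a h i m y + p1Lam a h i m' y ≤ 1 := by
    classical
    have hsub : ∑ k ∈ ({m, m'} : Finset (Fin 4)), p1Lam a h i k y ≤ ∑ k, p1Lam a h i k y :=
      Finset.sum_le_sum_of_subset_of_nonneg (Finset.subset_univ _) fun k _ _ => h0 k
    rw [Finset.sum_pair hne, hsum] at hsub
    exact hsub
  nlinarith [h0 m, h0 m', sq_nonneg (p1Lam a h i m y - p1Lam a h i m' y)]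

/-- **THE VERTEX-QUADRATURE EXCESS WITH A POINTWISE WEIGHT MAJORANT** (`0 ⪯ W(y)`, `q_{W(y)}(u) ≤ ω(y)|u|²` on the cell, `ω` continuous):
`Σ_m ∫_T λ_m·q_W(v_m) ≤ ∫_T q_W(ṽ) + ¼(∫_T ω)·½Σ_mΣ_{m'}|v_m − v_{m'}|²`.  NOT a proof of H12⋆, NOT summit progress. -/
theorem vertex_quadrature_excess_fun_p1RealCell {a h : ℝ} (ha : 0 < a) (hh : 0 < h) (i : (ℤ × ℤ × ℤ) × Fin 6)
    (W : (Fin 3 → ℝ) → Fin 3 → Fin 3 → ℝ) (hWc : ∀ k l, Continuous fun x => W x k l)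
    (hW0 : ∀ y ∈ p1RealCell a h i, ∀ u : Fin 3 → ℝ, 0 ≤ p1Quad3 (W y) u) {ω : (Fin 3 → ℝ) → ℝ} (hωc : Continuous ω)
    (hω : ∀ y ∈ p1RealCell a h i, ∀ u : Fin 3 → ℝ, p1Quad3 (W y) u ≤ ω y * (u 0 ^ 2 + u 1 ^ 2 + u 2 ^ 2)) (v : Fin 4 → Fin 3 → ℝ) :
    ∑ m, ∫ y in p1RealCell a h i, p1Lam a h i m y * p1Quad3 (W y) (v m) ≤
      (∫ y in p1RealCell a h i, p1Quad3 (W y) (fun k => ∑ m, p1Lam a h i m y * v m k)) +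
        1 / 4 * (∫ y in p1RealCell a h i, ω y) *
          (1 / 2 * ∑ m, ∑ m', ((v m 0 - v m' 0) ^ 2 + (v m 1 - v m' 1) ^ 2 + (v m 2 - v m' 2) ^ 2)) := by
  have hK := isCompact_p1RealCell ha.ne' hh.ne' i
  have hmeas : MeasurableSet (p1RealCell a h i) := (isClosed_p1RealCell a h i).measurableSet
  have hcl : ∀ m, Continuous (p1Lam a h i m) := continuous_p1Lam a h i
  have hq : ∀ u : Fin 3 → ℝ, Continuous fun y => p1Quad3 (W y) u := fun u =>
    continuous_p1Quad3_of_continuous hWc (u := fun _ => u) fun k => continuous_const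
  set E : ℝ := 1 / 2 * ∑ m : Fin 4, ∑ m' : Fin 4, ((v m 0 - v m' 0) ^ 2 + (v m 1 - v m' 1) ^ 2 + (v m 2 - v m' 2) ^ 2) with hE
  -- integrability
  have iA : ∀ m, IntegrableOn (fun y => p1Lam a h i m y * p1Quad3 (W y) (v m)) (p1RealCell a h i) volume := fun m =>
    ((hcl m).mul (hq _)).continuousOn.integrableOn_compact hK
  have iB : ∀ m m', IntegrableOn (fun y => p1Lam a h i m y * p1Lam a h i m' y * p1Quad3 (W y) (v m - v m')) (p1RealCell a h i) volume :=
    fun m m' => (((hcl m).mul (hcl m')).mul (hq _)).continuousOn.integrableOn_compact hK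
  have iQ : IntegrableOn (fun y => p1Quad3 (W y) (fun k => ∑ m, p1Lam a h i m y * v m k)) (p1RealCell a h i) volume := by
    have : Continuous fun y => p1Quad3 (W y) (fun k => ∑ m, p1Lam a h i m y * v m k) := by
      refine continuous_p1Quad3_of_continuous hWc fun k => ?_
      simp only [Fin.sum_univ_four]
      fun_prop
    exact this.continuousOn.integrableOn_compact hK
  have iS : IntegrableOn (fun y => ∑ m, p1Lam a h i m y * p1Quad3 (W y) (v m)) (p1RealCell a h i) volume :=
    integrable_finsetSum _ fun m _ => iA m
  have iD : IntegrableOn (fun y => 1 / 2 * ∑ m, ∑ m', p1Lam a h i m y * p1Lam a h i m' y * p1Quad3 (W y) (v m - v m'))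
      (p1RealCell a h i) volume :=
    (integrable_finsetSum _ fun m _ => integrable_finsetSum _ fun m' _ => iB m m').const_mul _
  have iω : IntegrableOn (fun y => 1 / 4 * ω y * E) (p1RealCell a h i) volume :=
    ((continuous_const.mul hωc).mul continuous_const).continuousOn.integrableOn_compact hK
  -- pointwise variance identity
  have hpt : ∀ y, (∑ m, p1Lam a h i m y * p1Quad3 (W y) (v m)) - p1Quad3 (W y) (fun k => ∑ m, p1Lam a h i m y * v m k) =
      1 / 2 * ∑ m, ∑ m', p1Lam a h i m y * p1Lam a h i m' y * p1Quad3 (W y) (v m - v m') :=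
    fun y => p1_variance_identity (W y) (fun m => p1Lam a h i m y) (sum_p1Lam_eq_one a h i y) v
  -- pointwise domination of the defect by `¼ ω(y) E`
  have hdom : ∀ y ∈ p1RealCell a h i,
      1 / 2 * ∑ m, ∑ m', p1Lam a h i m y * p1Lam a h i m' y * p1Quad3 (W y) (v m - v m') ≤ 1 / 4 * ω y * E := by
    intro y hy
    have hterm : ∀ m m', p1Lam a h i m y * p1Lam a h i m' y * p1Quad3 (W y) (v m - v m') ≤
        1 / 4 * ω y * ((v m 0 - v m' 0) ^ 2 + (v m 1 - v m' 1) ^ 2 + (v m 2 - v m' 2) ^ 2) := by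
      intro m m'
      by_cases hmm : m = m'
      · subst hmm
        simp [p1Quad3_zero]
      · have hl0 := mul_nonneg (p1Lam_nonneg_of_mem hy m) (p1Lam_nonneg_of_mem hy m')
        have hl4 := p1Lam_mul_le_quarter hy hmm
        have hq0 := hW0 y hy (v m - v m')
        have hb := hω y hy (v m - v m')
        simp only [Pi.sub_apply] at hb hq0
        have hω0 : 0 ≤ ω y * ((v m 0 - v m' 0) ^ 2 + (v m 1 - v m' 1) ^ 2 + (v m 2 - v m' 2) ^ 2) := hq0.trans hb
        calc p1Lam a h i m y * p1Lam a h i m' y * p1Quad3 (W y) (v m - v m')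
            ≤ p1Lam a h i m y * p1Lam a h i m' y * (ω y * ((v m 0 - v m' 0) ^ 2 + (v m 1 - v m' 1) ^ 2 + (v m 2 - v m' 2) ^ 2)) :=
              mul_le_mul_of_nonneg_left hb hl0
          _ ≤ 1 / 4 * (ω y * ((v m 0 - v m' 0) ^ 2 + (v m 1 - v m' 1) ^ 2 + (v m 2 - v m' 2) ^ 2)) :=
              mul_le_mul_of_nonneg_right hl4 hω0
          _ = 1 / 4 * ω y * ((v m 0 - v m' 0) ^ 2 + (v m 1 - v m' 1) ^ 2 + (v m 2 - v m' 2) ^ 2) := by ring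
    have hs := Finset.sum_le_sum fun m (_ : m ∈ Finset.univ) => Finset.sum_le_sum fun m' (_ : m' ∈ Finset.univ) => hterm m m'
    rw [hE]
    have e : ∑ m : Fin 4, ∑ m' : Fin 4, 1 / 4 * ω y * ((v m 0 - v m' 0) ^ 2 + (v m 1 - v m' 1) ^ 2 + (v m 2 - v m' 2) ^ 2) =
        1 / 4 * ω y * ∑ m : Fin 4, ∑ m' : Fin 4, ((v m 0 - v m' 0) ^ 2 + (v m 1 - v m' 1) ^ 2 + (v m 2 - v m' 2) ^ 2) := by
      simp_rw [Finset.mul_sum]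
    nlinarith [hs, e]
  have hD : ∫ y in p1RealCell a h i, 1 / 2 * ∑ m, ∑ m', p1Lam a h i m y * p1Lam a h i m' y * p1Quad3 (W y) (v m - v m') ≤
      1 / 4 * (∫ y in p1RealCell a h i, ω y) * E := by
    refine (setIntegral_mono_on iD iω hmeas hdom).trans (le_of_eq ?_)
    rw [integral_mul_const, integral_const_mul]
  have hdiff : (∫ y in p1RealCell a h i, ∑ m, p1Lam a h i m y * p1Quad3 (W y) (v m)) -
      ∫ y in p1RealCell a h i, p1Quad3 (W y) (fun k => ∑ m, p1Lam a h i m y * v m k) =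
      ∫ y in p1RealCell a h i, 1 / 2 * ∑ m, ∑ m', p1Lam a h i m y * p1Lam a h i m' y * p1Quad3 (W y) (v m - v m') := by
    rw [← integral_sub iS iQ]
    exact setIntegral_congr_fun hmeas fun y _ => hpt y
  rw [← integral_finsetSum _ fun m _ => iA m]
  linarith [hD, hdiff]

end Summit.AtomisticToContinuum.Crystallization.Theorems.StrictSplittingRuleBirth
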